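import Mathlib
import Summits.RiemannHypothesis.RiemannHypothesis.Theorems.WeilFarCoercivityFloor
import Summits.RiemannHypothesis.RiemannHypothesis.Theorems.WeilFarFloorOrder
import Summits.RiemannHypothesis.RiemannHypothesis.Theorems.WeilFarFloorKappaRoot
import HarnessLib

/-!
# The floor law's `κ(a)` and `L(a)` made honest: `pntKappa a` IS the root of `κ·tanh(κa) = ½`, and `pntFloor a` IS the eigenvalue

Helper file (`--supports stmt-RiemannHypothesis-0098`, lead-track anchor: Weil-positivity window ladder, format-C far bound),
RH-free, pure proofs.  Seat rh-explicit-weil-1 gen8 (memo `run/shared/lean/pub/rh-explicit/rh-explicit-weil-1/FORMAT-K3.md` §9.10).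

`WeilFarCoercivityFloor` defines `pntKappa a := sInf {κ | ½ < κ ∧ ½ ≤ κ·tanh(κa)}` and `pntFloor a := 1/(pntKappa a² − ¼)` (the
`L(a)` of STRUCTURE.md C-XIII) by description.  Here, for every `a > 0`: the set is `[κ*, ∞)` for the unique root `κ* > ½` of
`2κ·sinh(κa) = cosh(κa)` (`ψ_a(κ) = 2κ sinh(κa) − cosh(κa)` is strictly increasing on `[½, ∞)` with `ψ_a(½) < 0 < ψ_a(1 + 1/a)`,
intermediate value theorem), so `pntKappa a > ½` and `pntKappa a · sinh(pntKappa a · a) = cosh(pntKappa a · a)/2`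
(`pntKappa_spec`); consequently (`WeilFarFloorOrder` §2) `cosh(pntKappa a · x)` is an eigenfunction of the PNT kernel
`e^{|x−y|/2}` on `[−a, a]` with eigenvalue `pntFloor a` (`pntFloor_eigenfunction`), `pntFloor a = e^{2κa}/(κ + ½)²`, and
`e^{a} ≤ pntFloor a` (`a ≥ 1`), `pntFloor a ≤ e^{a} + 4a` (`a ≥ 2`) — the main term of the floor law is `e^a + O(a)` by theorem.
Standard axioms only.
-/

set_option linter.dupNamespace false
set_option autoImplicit false

noncomputable section

open MeasureTheory Set intervalIntegral
open scoped Real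

namespace Summit.RiemannHypothesis.RiemannHypothesis.Theorems.WeilFormatC

/-! ### Consequences for `pntKappa` and `pntFloor` -/

/-- **`pntKappa a` is the root**: for `a > 0`, `½ < pntKappa a` and `pntKappa a · sinh(pntKappa a · a) = cosh(pntKappa a · a)/2`
(equivalently `κ·tanh(κa) = ½`). -/
theorem pntKappa_spec {a : ℝ} (ha : 0 < a) :
    1 / 2 < pntKappa a ∧ pntKappa a * Real.sinh (pntKappa a * a) = Real.cosh (pntKappa a * a) / 2 :=
  FloorGrowth.sInf_pntKappaSet_spec ha

/-- **`pntFloor a` in closed form**: `pntFloor a = e^{2κa}/(κ + ½)²`, `κ = pntKappa a` (`a > 0`). -/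
theorem pntFloor_eq {a : ℝ} (ha : 0 < a) :
    pntFloor a = Real.exp (2 * (pntKappa a * a)) / (pntKappa a + 1 / 2) ^ 2 := by
  obtain ⟨hκ, heig⟩ := pntKappa_spec ha
  unfold pntFloor
  exact FloorGrowth.inv_kappa_sq_sub_quarter_eq hκ heig

/-- **`pntFloor a` is the eigenvalue**: for `a > 0` and `x ∈ [−a, a]`,
`∫_{−a}^{a} e^{|x−y|/2} cosh(pntKappa a · y) dy = pntFloor a · cosh(pntKappa a · x)`. -/
theorem pntFloor_eigenfunction {a x : ℝ} (ha : 0 < a) (hx : x ∈ Icc (-a) a) :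
    ∫ y in (-a)..a, Real.exp (|x - y| / 2) * Real.cosh (pntKappa a * y) = pntFloor a * Real.cosh (pntKappa a * x) := by
  obtain ⟨hκ, heig⟩ := pntKappa_spec ha
  have hκ2 : pntKappa a ^ 2 ≠ 1 / 4 := by nlinarith
  rw [FloorGrowth.pnt_kernel_eigenfunction hκ2 heig hx]
  unfold pntFloor
  ring

/-- **`e^{a} ≤ L(a)`** for `a ≥ 1`. -/
theorem exp_le_pntFloor {a : ℝ} (ha : 1 ≤ a) : Real.exp a ≤ pntFloor a := by
  obtain ⟨hκ, heig⟩ := pntKappa_spec (by linarith : 0 < a)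
  exact FloorGrowth.exp_le_inv_kappa_sq_sub_quarter ha hκ heig

/-- **`L(a) ≤ e^{a} + 4a`** for `a ≥ 2`: the floor law's main term is `e^a + O(a)` by theorem. -/
theorem pntFloor_le {a : ℝ} (ha : 2 ≤ a) : pntFloor a ≤ Real.exp a + 4 * a := by
  obtain ⟨hκ, heig⟩ := pntKappa_spec (by linarith : 0 < a)
  exact FloorGrowth.inv_kappa_sq_sub_quarter_le ha hκ heig

end Summit.RiemannHypothesis.RiemannHypothesis.Theorems.WeilFormatC
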